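import Summits.ResolutionOfSingularities.ResolutionOfSingularities.Theorems.TameCutStage
import HarnessLib

/-!
# LatencyCutKernels — decomp-res node «LatencyCut» (lens-4 g22) refining the MaxContactCut asides 28054 / 32260;
tree file 2/5 of the node

Content VERBATIM from the decomp-res lens-4 g22 file `HOME/decomp-res-lens-4/g22/LatencyCut.lean` (sha256 6bd4fa7be8c896a2,
940 l, written directly against the tree on top of the landed g21 node «TameCut» = `Theorems/TameCutClasses`,
`TameCutKernels`,
`MaxContactCutTameCut`).  HOME = run/shared/lean/pub/decomp-res.  Critic: CRITIC-LEDGER row 137 CLEARED, landing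
order 2026-08-30T19:54:01Z.

Route-independent, cone-free: §49 CONTACT LATENCY (hypothesis-free, standard axioms) — an ABSOLUTE contact
element at SOME stage makes the
tower a contact tower; the contact stages form an UP-SET; a tame weight at a separable-residue point of ANY stage
gives contact there
(`contactHugging_of_isAbsContactAt_stage`, `isAbsContactAt_of_tame_sepStage`, …); §53 THE ARITHMETIC CERTIFICATE
of the census proxy
(`dvd_choose_mul_of_not_dvd`, `not_dvd_choose_sub_one_of_not_dvd`).

[WRITER NOTE (decomp-res writer g7): namespace `…Theorems.HugValuationCut` as the whole lens-4 chain; split by the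
critic's order into
`TameCutStage` (§48), `LatencyCutKernels` (§49 + §53), `LatencyCutClasses` (§50) + `LatencyCutCells` (§51 + the
§52 all-weights CLASSES; the
critic's single `LatencyCutClasses` exceeds the 400-line file limit, hence two files), all four route-independent
(OUTSIDE the Theses cone,
importing only the cone-free `TameCutKernels` instead of the lens's `MaxContactCutTameCut`), and
`MaxContactCutLatencyCut` (inside the cone:
the §52 BY-NAME theorems + the two port-conditional theorems `noTowerPerfect_latent_of_ports` (§50) /
`latentPerfectOffLocus_of_ports` (§51),
whose binder `MaxContactCut.MarkedThreefoldResolution` is a route decl).  `section StageKernel` re-opened in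
`LatencyCutKernels`; the global
`set_option linter.dupNamespace false` dropped; the lens's consistency restatement
`contactHugging_of_isAbsContactAt_root'` (≡ the landed
`TameCutKernels.contactHugging_of_isAbsContactAt_root`, dedup.landed) deleted; nothing else changed.]

(Sources: Giraud1975; EncinasVillamayor2000 Thm. 4.9; BravoGarciaEscamillaVillamayor2012 Lemma 4.6; EGAIV4 Thm.
16.11.2; CossartPiltant2008 Prop. 4.2; BierstoneGrigorievMilmanWlodarczyk2011 Lemma 3.4; GortzWedhorn2020 Prop.
13.96; Liu2002 Thm. 8.1.19; Matsumura1987 Thm. 15.5, Thm. 30.5; CossartJannsenSaito2020; CossartPiltant2019;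
Hironaka1964; Moh1987; Cutkosky2009 Thm. 5.1.)
-/

noncomputable section

open CategoryTheory AlgebraicGeometry IsLocalRing
open Literature.AlgebraicGeometry.Resolution
open Summit.ResolutionOfSingularities.ResolutionOfSingularities.Theorems
open WeakOrderReduction ForcedTowerClasses DivergentTowerClasses MonomialTowerClasses
open HugDimensionClasses HugDimensionKernels SurfaceShadowClasses SurfaceShadowKernels
open ContactShadowClasses (NoTowerImperfect ContactShadow TowerObstructsAll ContactPerfect)
open ContactShadowKernels (noTowerImperfect_of_noTower noTowerImperfect_mono noTower_iff_columns)
open NearPointCut (SingularClass singularSurface_iff_noTower)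
open AbsoluteContactClasses (IsAbsContactAt SepResidueAt AbsInv absInv_point hsPortSepResidue sepResidueAt_of_perfectField not_perfectField_of_not_sepResidueAt diffIdeal_restrict_le)

namespace Summit.ResolutionOfSingularities.ResolutionOfSingularities.Theorems.HugValuationCut

section StageKernel

variable {k : Type} [Field k]

/-! ## §49 (g22 · NEW · KERNEL, hypothesis-free, standard axioms) CONTACT LATENCY — an ABSOLUTE contact element at ANY
stage makes the tower a contact tower; the contact stages form an UP-SET; a tame weight at a separable-residue point of
ANY stage gives contact there -/
/-- **GIRAUD PERSISTENCE FROM STAGE `m`** — g21's `tower_absInv_strictIter` re-rooted: the invariant `AbsInv` holds at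
every stage `m + j` once it holds at stage `m`. (Sources: EncinasVillamayor2000, Thm. 4.9; Giraud1975.) -/
theorem tower_absInv_strictIter_from (T : ForcedTower) (g : T.St 0 ⟶ Spec (.of k)) (hB : IsBase (T.St 0) g) {N : ℕ}
    (hD : IsDatum (N + 1) (T.D 0)) (m : ℕ) (H : (T.St m).IdealSheafData) (hm : AbsInv (T.D m).ideal H N (T.pt m)) :
    ∀ j, AbsInv (T.D (m + j)).ideal (strictIter T m H j) N (T.pt (m + j)) := by
  intro j
  induction j with
  | zero => exact hm
  | succ j ih => exact tower_absInv_succ T g hB hD (m + j) (strictIter T m H j) ih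

/-- **KERNEL (PROVED) · THE LATENCY ENGINE: AN ABSOLUTE CONTACT ELEMENT AT ANY STAGE `m` MAKES THE TOWER HUG A
REGULAR HYPERSURFACE GERM FROM THAT STAGE ON** — spread the element to an ideal sheaf `H` on the (Noetherian, §48) stage
`T.St m` (tree `centreSpread`), persist from `m` (`tower_absInv_strictIter_from`), read off `ord_{x_m} H = 1` and
`HugsGerm T m H`.  No field, no residue, no weight hypothesis: the predicate `IsAbsContactAt` is absolute. (Sources:
Giraud1975; EncinasVillamayor2000, Thm. 4.9; BravoGarciaEscamillaVillamayor2012, Lemma 4.6.) -/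
theorem hugsGerm_of_isAbsContactAt_stage (T : ForcedTower) (g : T.St 0 ⟶ Spec (.of k)) (hB : IsBase (T.St 0) g)
    {N : ℕ} (hD : IsDatum (N + 1) (T.D 0)) (m : ℕ) (habs : IsAbsContactAt (T.D m).ideal (N + 1) (T.pt m)) :
    ∃ H : (T.St m).IdealSheafData, idealOrder H (T.pt m) = 1 ∧ HugsGerm T m H := by
  obtain ⟨u, hu, hum, hu2⟩ := habs
  rw [Nat.add_sub_cancel] at hu
  haveI := tower_isNoetherian T g hB m
  have hu0 : u ≠ 0 := fun h => hu2 (by rw [h]; exact zero_mem _)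
  have hspan : Ideal.span (Set.range fun _ : Fin 1 => u) = Ideal.span {u} := by rw [Set.range_const]
  obtain ⟨H, -, -, hHst⟩ := FInjectiveMacaulayfication.CentreSpread.centreSpread (T.St m) (T.pt m) 1 (fun _ => u)
      (by rw [hspan, Ne, Ideal.span_singleton_eq_bot]; exact hu0)
      (by rw [hspan]; exact (Ideal.span_singleton_le_iff_mem _).mpr hum)
  rw [hspan] at hHst
  have hinv := tower_absInv_strictIter_from T g hB hD m H ⟨u, hHst, hu, hum, hu2⟩
  have hord1 : idealOrder H (T.pt m) = 1 := by
    refine le_antisymm ?_ ?_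
    · by_contra hlt
      rw [not_le] at hlt
      have h2 : ((2 : ℕ) : ℕ∞) ≤ idealOrder H (T.pt m) := by
        have : (1 : ℕ∞) + 1 ≤ idealOrder H (T.pt m) := (ENat.add_one_le_iff (ENat.coe_ne_top 1)).mpr hlt
        exact_mod_cast this
      rw [le_idealOrder_iff, hHst] at h2
      exact hu2 (h2 (Ideal.mem_span_singleton_self u))
    · rw [show (1 : ℕ∞) = ((1 : ℕ) : ℕ∞) from rfl, le_idealOrder_iff, hHst, pow_one]
      exact (Ideal.span_singleton_le_iff_mem _).mpr hum
  refine ⟨H, hord1, ?_, fun j => ?_⟩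
  · rw [hord1]; exact ENat.coe_ne_top 1
  · obtain ⟨z, hHz, -, hzm, -⟩ := hinv j
    exact (mem_support_iff_stalkIdeal_le _ _).mpr (by rw [hHz]; exact (Ideal.span_singleton_le_iff_mem _).mpr hzm)

/-- **KERNEL (PROVED): AN ABSOLUTE CONTACT ELEMENT AT ANY STAGE MAKES THE FORCED TOWER A CONTACT TOWER** (witness stage =
the contact stage). (Sources: Giraud1975; EncinasVillamayor2000, Thm. 4.9.) -/
theorem contactHugging_of_isAbsContactAt_stage (T : ForcedTower) (g : T.St 0 ⟶ Spec (.of k)) (hB : IsBase (T.St 0) g)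
    {N : ℕ} (hD : IsDatum (N + 1) (T.D 0)) (m : ℕ) (habs : IsAbsContactAt (T.D m).ideal (N + 1) (T.pt m)) :
    ContactHugging T := by
  obtain ⟨H, h1, h2⟩ := hugsGerm_of_isAbsContactAt_stage T g hB hD m habs
  exact ⟨m, H, h1, h2⟩

/-- **KERNEL (PROVED): THE CONTACT STAGES FORM AN UP-SET** — an absolute contact element at stage `j` yields one at
stage `j + 1` (the generator of the strict transform of the spread hypersurface: g21 `tower_absInv_succ`). (Sources:
Giraud1975; EncinasVillamayor2000, Thm. 4.9.) -/
theorem isAbsContactAt_succ (T : ForcedTower) (g : T.St 0 ⟶ Spec (.of k)) (hB : IsBase (T.St 0) g) {N : ℕ}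
    (hD : IsDatum (N + 1) (T.D 0)) (j : ℕ) (habs : IsAbsContactAt (T.D j).ideal (N + 1) (T.pt j)) :
    IsAbsContactAt (T.D (j + 1)).ideal (N + 1) (T.pt (j + 1)) := by
  obtain ⟨u, hu, hum, hu2⟩ := habs
  rw [Nat.add_sub_cancel] at hu
  haveI := tower_isNoetherian T g hB j
  have hu0 : u ≠ 0 := fun h => hu2 (by rw [h]; exact zero_mem _)
  have hspan : Ideal.span (Set.range fun _ : Fin 1 => u) = Ideal.span {u} := by rw [Set.range_const]
  obtain ⟨H, -, -, hHst⟩ := FInjectiveMacaulayfication.CentreSpread.centreSpread (T.St j) (T.pt j) 1 (fun _ => u)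
      (by rw [hspan, Ne, Ideal.span_singleton_eq_bot]; exact hu0)
      (by rw [hspan]; exact (Ideal.span_singleton_le_iff_mem _).mpr hum)
  rw [hspan] at hHst
  obtain ⟨z, -, hz, hzm, hz2⟩ := tower_absInv_succ T g hB hD j H ⟨u, hHst, hu, hum, hu2⟩
  refine ⟨z, ?_, hzm, hz2⟩
  rw [Nat.add_sub_cancel]
  exact hz

/-- **KERNEL (PROVED): monotonicity in the stage** — absolute contact at stage `i` gives absolute contact at every
later stage `j ≥ i`. [folklore] -/
theorem isAbsContactAt_of_le (T : ForcedTower) (g : T.St 0 ⟶ Spec (.of k)) (hB : IsBase (T.St 0) g) {N : ℕ}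
    (hD : IsDatum (N + 1) (T.D 0)) {i j : ℕ} (hij : i ≤ j) (habs : IsAbsContactAt (T.D i).ideal (N + 1) (T.pt i)) :
    IsAbsContactAt (T.D j).ideal (N + 1) (T.pt j) := by
  obtain ⟨d, rfl⟩ := Nat.exists_eq_add_of_le hij
  induction d with
  | zero => exact habs
  | succ d ih => exact isAbsContactAt_succ T g hB hD (i + d) (ih (Nat.le_add_right i d))

/-- **KERNEL (PROVED): THE TAME CONTACT THEOREM AT EVERY STAGE** — a weight `n` prime to `p` and a separable residue
field at the point `x_m` of SOME stage (for the composite structure map `toRoot T m ≫ g`; §48 makes `T.St m` a base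
and `(I_m, n)` a datum of maximal order `n`) give an absolute contact element at `x_m` (g21 `isAbsContactAt_of_tame_sep`
on the stage), hence a contact tower. (Sources: EGAIV4, Thm. 16.11.2; Giraud1975; EncinasVillamayor2000, Thm. 4.9.) -/
theorem isAbsContactAt_of_tame_sepStage {p : ℕ} (hp : p.Prime) {n : ℕ} (hpn : ¬ p ∣ n) {K : Type} [Field K] [CharP K p]
    (T : ForcedTower) (g : T.St 0 ⟶ Spec (.of K)) (hB : IsBase (T.St 0) g) (hD : IsDatum n (T.D 0)) (m : ℕ)
    (hsep : SepResidueAt (toRoot T m ≫ g) (T.pt m)) : IsAbsContactAt (T.D m).ideal n (T.pt m) :=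
  isAbsContactAt_of_tame_sep hp (toRoot T m ≫ g) (tower_isBase T g hB m) (T.D m).ideal (T.isClosed_pt m) hsep
    (tower_idealOrder_pt_eq T g hB hD m) hpn

/-- **THE TAME CONTACT THEOREM AT EVERY STAGE, tower form**: `p ∤ n` and `κ(x_m)` separable over `k` for some `m`
⇒ `ContactHugging T`. (Sources: Giraud1975; EncinasVillamayor2000, Thm. 4.9; EGAIV4, Thm. 16.11.2.) -/
theorem contactHugging_of_tame_sepStage {p : ℕ} (hp : p.Prime) {n : ℕ} (hpn : ¬ p ∣ n) {K : Type} [Field K] [CharP K p]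
    (T : ForcedTower) (g : T.St 0 ⟶ Spec (.of K)) (hB : IsBase (T.St 0) g) (hD : IsDatum n (T.D 0)) (m : ℕ)
    (hsep : SepResidueAt (toRoot T m ≫ g) (T.pt m)) : ContactHugging T := by
  obtain ⟨N, rfl⟩ : ∃ N, n = N + 1 :=
    ⟨n - 1, by have : n ≠ 0 := fun h => hpn (h ▸ dvd_zero p); omega⟩
  exact contactHugging_of_isAbsContactAt_stage T g hB hD m (isAbsContactAt_of_tame_sepStage hp hpn T g hB hD m hsep)

end StageKernel

/-! ## §53 (g22 · NEW · KERNEL, hypothesis-free) THE ARITHMETIC CERTIFICATE OF THE CENSUS PROXY — Hasse derivatives of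
order prime to `p` send `p`-th-power monomials to multiples of `p` (Lucas); with g21 §47 `choose_sub_one_eq`
(`∂^{[a−1]} x^a = a·x`) this is the dictionary «`in_n f` has a monomial with an exponent `≢ 0 mod p`» ⟺
«absolute contact
of order `≤ n − 1` at an `𝔽_p`-point of a hypersurface of order `n`» used by the instrument T-wild-in -/

/-- **Lucas: `p ∣ C(p·a, i)` whenever `p ∤ i`** — a differential operator `∂^{[i]}` of order `i ≢ 0 mod
p` maps `x^{pa}`
into `p · ℤ[x] = 0` in characteristic `p`; Frobenius-type initial forms have no contact element. [folklore] -/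
theorem dvd_choose_mul_of_not_dvd {p : ℕ} (hp : p.Prime) (a : ℕ) {i : ℕ} (hi : ¬ p ∣ i) : p ∣ (p * a).choose i := by
  haveI := Fact.mk hp
  have h := Choose.choose_modEq_choose_mod_mul_choose_div_nat (n := p * a) (k := i) (p := p)
  have hi' : 0 < i % p := Nat.pos_of_ne_zero fun h0 => hi (Nat.dvd_of_mod_eq_zero h0)
  rw [Nat.mul_mod_right, Nat.choose_eq_zero_of_lt hi', zero_mul] at h
  exact Nat.modEq_zero_iff_dvd.mp h

/-- the complementary tame certificate (g21 §47, restated at the multiple): `C(a, a − 1) = a`, so `∂^{[a−1]} x^a = a·x`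
is a contact element as soon as `p ∤ a`. [folklore] -/
theorem not_dvd_choose_sub_one_of_not_dvd {p a : ℕ} (ha : 1 ≤ a) (hpa : ¬ p ∣ a) : ¬ p ∣ a.choose (a - 1) := by
  rw [choose_sub_one_eq a ha]
  exact hpa

end Summit.ResolutionOfSingularities.ResolutionOfSingularities.Theorems.HugValuationCut
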